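import Literature.AlgebraicGeometry.GroupSchemes.CartierDualAnnihilatorRank          -- ★ p845797 `finrank_alg_ker_mul_finrank`; transitively ★ `GroupSchemeKernelAlg` (`finrank_alg_ker_eq`), ★ `AffineGroupSchemeBialgHom` (`Alg.comapBialgHom`), ★ `FreeOverSubbialgebra`
import Literature.AlgebraicGeometry.Motives.TannakianDeligneTorusMumfordTateProduct   -- ★ Milne 3.11 `Tannakian.isCoideal_ker_bialgHom` ∕ `isHopfIdeal_ker_bialgHom`
import HarnessLib

/-!
# The image ideal of a homomorphism of finite group schemes over a field is recognised by its rank: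
# `rk (Γ(G₂) ⧸ ker Γ(φ)) · rk (Ker φ) = rk G₁`, and an ideal below `ker Γ(φ)` of that corank IS `ker Γ(φ)`

Layer `Literature/AlgebraicGeometry/GroupSchemes`, namespace `Literature.AlgebraicGeometry.GroupSchemes.AffineGroupScheme` (continues ★
`CartierDualAnnihilatorRank` §1 — `finrank_alg_ker_mul_finrank : rk Γ(Ker φ) · rk Γ(G₂) = rk Γ(G₁)` for `Γ(φ)` INJECTIVE —, ★ `GroupSchemeKernelAlg`
— the ideal `J(φ) := φ^*(Γ(G₂)⁺)·Γ(G₁)` of `Ker φ`, `finrank_alg_ker_eq` —, ★ `FreeOverSubbialgebra` — `finrank_mul_finrank_of_injective` — and ★ Milne 3.11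
`Tannakian.isCoideal_ker_bialgHom`).  THEOREMS ONLY: no definition, no instance, no notation, no named fact, no `sorry`.  Cell `hodgecm-mathlib`
(D-0151), programme P6 «MOD», line L2 of the D-line socket `stub_DOWN` (`Cruxes/HLiu418/Lines/F0_P6a_DatumOfInputs.lean` ED. 1 :515), sub-organ
**(D6-rk) «IMAGE IDEAL RECOGNISED BY RANK»** of organ (O1) `stub_SPEC` (LA2-plan (g0) deal 2026-09-02T02:06Z; payer LA2-p01 (g0)): the downstairs D6 law
`QuotQuot₀Law` receives an admissible ideal `H′` with ONLY the inclusion `H′ ≤ ker Γ(isogW₀ x̄ H)`; this file is the generic pin that turns that inclusion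
plus the rank count `q · q = q²` into the EQUALITY `H′ = ker Γ(isogW₀ x̄ H)` («`H′` IS the image line»), and records the rank of the scheme-theoretic image
of a homomorphism of finite group schemes.  Count-neutral Mathlib-side capital: HC_CM is proved only modulo the 7 printed citations (2 remaining named
inputs hLiu418 24832, h413 24833) until rung 0 closes; nothing here bears on it.

THE PRINT.  [Milne2017] Ch. 3 §b Prop. 3.9 («the image of a homomorphism `f : A → B` of Hopf algebras is a Hopf subalgebra of `B`») and Prop. 3.11
(«the kernel of a homomorphism of Hopf `k`-algebras is a Hopf ideal» — the scheme-theoretic image `V(ker Γ(φ)) ⊆ G₂` of `φ : G₁ → G₂` is a closed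
subgroup scheme); [Milne2017] Ch. 11 §b Prop. 11.10 («`o(G) = o(H) · o(G/H)`», orders of locally free finite group schemes multiply); [Waterhouse1979] §14.1
Theorem (a commutative Hopf algebra is faithfully flat — in the finite case FREE, [Montgomery1993Hopf] Thm. 3.1.5 ∕ Cor. 3.2.1 — over a Hopf subalgebra).
Applied to the factorisation `Γ(G₂) ↠ Γ(G₂) ⧸ ker Γ(φ) ↪ Γ(G₁)`: `Γ(G₁)` is free over the image Hopf subalgebra `Γ(G₂) ⧸ ker Γ(φ)` with
`Γ(G₁) ⧸ (image)⁺Γ(G₁) = Γ(G₁) ⧸ J(φ) = Γ(Ker φ)`, whence **`rk (Γ(G₂) ⧸ ker Γ(φ)) · rk Γ(Ker φ) = rk Γ(G₁)`**.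

DATA.  `k` a field.
* §1 (linear algebra) `A` a commutative `k`-algebra, `I ≤ J` ideals with `A ⧸ I` finite-dimensional:
  **`ideal_eq_of_le_of_finrank_quotient_le` — `I ≤ J` and `dim (A ⧸ I) ≤ dim (A ⧸ J)` force `I = J`** (the surjection `A ⧸ I ↠ A ⧸ J` is then injective).
* §2 (Hopf algebra) `f : A →ₐc[k] B` a bialgebra map of a commutative bialgebra into a finite-dimensional commutative Hopf algebra, `I := ker f`
  (a coideal, ★ Milne 3.11), `f̄ : A ⧸ I → B` the induced INJECTIVE bialgebra map (`counitAlgHom_comp_liftₐ`, `map_liftₐ_comp_comulAlgHom` are its two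
  compatibilities; `map_ker_counit_liftₐ_eq` says `f̄((A⧸I)⁺)B = f(A⁺)B`): **`finrank_quotient_ker_mul_finrank_quotient_map_ker_counit` —
  `dim (A ⧸ ker f) · dim (B ⧸ f(A⁺)B) = dim B`**.
* §3 (schemes) `φ : G₁ ⟶ G₂` a homomorphism (`IsMonHom`) of affine group objects of `SchemeOver k` with `Γ(G₁)` finite, `Γ(φ) = Alg.comap φ`
  (`= φ.left.appTop.hom` on elements, ★ `Alg.comap_apply`), `J(φ) := (ker ε₂).map Γ(φ)` the ideal of `Ker φ` (★ `ker_appTop_kerι_eq`):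
  **`finrank_quotient_ker_comap_mul_finrank_quotient_map_ker_counit` — `dim (Γ(G₂) ⧸ ker Γ(φ)) · dim (Γ(G₁) ⧸ J(φ)) = dim Γ(G₁)`**, the same with
  `Γ(Ker φ)` (`finrank_quotient_ker_comap_mul_finrank_alg_ker`), divisibility, the image corank as a quotient (`finrank_quotient_ker_comap_eq_div`) and in
  numbers (`finrank_quotient_ker_comap_eq_of_finrank_eq`: `dim Γ(G₁) = n·m`, `dim (Γ(G₁) ⧸ J(φ)) = m ≠ 0 ⟹ dim (Γ(G₂) ⧸ ker Γ(φ)) = n`); the image ideal is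
  a Hopf ideal (`isHopfIdeal_ker_comap`, Milne 3.11 in scheme clothing); the image ideal of the closed
  subgroup `Spec (Γ(G) ⧸ I) ↪ G` is `I` by ★ `ker_appTop_quotIncl` (cited, not restated).
* §4 HEAD (the D6 pin), for `Γ(G₂)` finite too: **`eq_ker_comap_of_le_of_finrank_quotient_mul_eq` — an ideal `I ≤ ker Γ(φ)` with
  `dim (Γ(G₂) ⧸ I) · dim (Γ(G₁) ⧸ J(φ)) = dim Γ(G₁)` IS `ker Γ(φ)`**; the numeric form `eq_ker_comap_of_le_of_finrank_eq` (`dim Γ(G₁) = n·m`,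
  `dim (Γ(G₁) ⧸ J(φ)) = m`, `dim (Γ(G₂) ⧸ I) = n`); the `φ.left.appTop.hom` spellings `eq_ker_appTop_of_le_of_finrank_eq` (the D-line՚s `QuotQuot₀Law`
  currency `RingHom.ker (isogW₀ x̄ H).left.appTop.hom`); and the two-ideal corollary `eq_of_le_ker_comap_of_finrank_eq` (two ideals below `ker Γ(φ)` of
  the image corank are equal — «`H′` and the specialised backtracking line coincide»).

## References
* [Milne2017] J. S. Milne, *Algebraic Groups*, CUP (2017) — Ch. 3 §b Prop. 3.9, Prop. 3.11, Prop. 3.15 (held text `book:milnend-algebraic-groups` p0146–p0147);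
  Ch. 11 §b Prop. 11.10 (p0271).
* [Waterhouse1979] W. C. Waterhouse, *Introduction to Affine Group Schemes*, GTM 66 (1979) — §14.1 Theorem; §2.1 (kernels, closed subgroups), p. 14.
* [Montgomery1993Hopf] S. Montgomery, *Hopf algebras and their actions on rings*, CBMS 82 (1993) — Thm. 3.1.5, Cor. 3.2.1 (p. 30).
-/

set_option autoImplicit false

-- Mathlib's `Over`/`Scheme` APIs are stated across semireducible wrappers (as in the ★ `GroupSchemes/*` files).
set_option backward.isDefEq.respectTransparency false

universe u v w

open CategoryTheory CategoryTheory.Limits AlgebraicGeometry MonoidalCategory CartesianMonoidalCategory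

noncomputable section

namespace Literature.AlgebraicGeometry.GroupSchemes

namespace AffineGroupScheme

open scoped MonObj

open Literature.AlgebraicGeometry.Motives Literature.NumberTheory.DiophantineGeometry Literature.RingTheory.HopfAlgebra
  GroupSchemeKernel

/-! ## §1 Corank recognition: `I ≤ J` and `dim (A ⧸ I) ≤ dim (A ⧸ J)` force `I = J` -/

section Corank

variable {k : Type u} {A : Type v} [Field k] [CommRing A] [Algebra k A]

/-- **CORANK RECOGNITION.** For ideals `I ≤ J` of a commutative `k`-algebra with `A ⧸ I` finite-dimensional, `dim_k (A ⧸ I) ≤ dim_k (A ⧸ J)` forces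
`I = J`: the surjection `A ⧸ I ↠ A ⧸ J` between spaces of equal finite dimension is injective, so every `x ∈ J` dies in `A ⧸ I`.  (The rank bookkeeping behind
«a closed subgroup scheme of the same order as the ambient finite group scheme is all of it».) [cite: Milne2017, Ch. 11 §b Prop. 11.10] -/
theorem ideal_eq_of_le_of_finrank_quotient_le {I J : Ideal A} [FiniteDimensional k (A ⧸ I)] (hIJ : I ≤ J)
    (h : Module.finrank k (A ⧸ I) ≤ Module.finrank k (A ⧸ J)) : I = J := by
  let g : (A ⧸ I) →ₐ[k] (A ⧸ J) := Ideal.Quotient.factorₐ k hIJ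
  have hg : Function.Surjective g := Ideal.Quotient.factor_surjective hIJ
  haveI : FiniteDimensional k (A ⧸ J) := Module.Finite.of_surjective g.toLinearMap hg
  have heq : Module.finrank k (A ⧸ I) = Module.finrank k (A ⧸ J) :=
    le_antisymm h (LinearMap.finrank_le_finrank_of_surjective (f := g.toLinearMap) hg)
  have hinj : Function.Injective g :=
    (LinearMap.injective_iff_surjective_of_finrank_eq_finrank heq (f := g.toLinearMap)).mpr hg
  refine le_antisymm hIJ fun x hx => ?_
  have hgx : g (Ideal.Quotient.mk I x) = g 0 := by
    rw [map_zero]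
    change Ideal.Quotient.factor hIJ (Ideal.Quotient.mk I x) = 0
    rw [Ideal.Quotient.factor_mk, Ideal.Quotient.eq_zero_iff_mem]
    exact hx
  exact Ideal.Quotient.eq_zero_iff_mem.mp (hinj hgx)

/-- Equality form of corank recognition: `I ≤ J` and `dim_k (A ⧸ I) = dim_k (A ⧸ J)` force `I = J`. [cite: Milne2017, Ch. 11 §b Prop. 11.10] -/
theorem ideal_eq_of_le_of_finrank_quotient_eq {I J : Ideal A} [FiniteDimensional k (A ⧸ I)] (hIJ : I ≤ J)
    (h : Module.finrank k (A ⧸ I) = Module.finrank k (A ⧸ J)) : I = J :=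
  ideal_eq_of_le_of_finrank_quotient_le hIJ h.le

/-- Two ideals below a third one, all three of the same finite corank, are equal. [cite: Milne2017, Ch. 11 §b Prop. 11.10] -/
theorem ideal_eq_of_le_of_le_of_finrank_quotient_eq {I₁ I₂ J : Ideal A} [FiniteDimensional k (A ⧸ I₁)] [FiniteDimensional k (A ⧸ I₂)]
    (h₁ : I₁ ≤ J) (h₂ : I₂ ≤ J) (hr₁ : Module.finrank k (A ⧸ I₁) = Module.finrank k (A ⧸ J))
    (hr₂ : Module.finrank k (A ⧸ I₂) = Module.finrank k (A ⧸ J)) : I₁ = I₂ := by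
  rw [ideal_eq_of_le_of_finrank_quotient_eq h₁ hr₁, ideal_eq_of_le_of_finrank_quotient_eq h₂ hr₂]

end Corank

/-! ## §2 The image of a bialgebra map into a finite commutative Hopf algebra: `dim (A ⧸ ker f) · dim (B ⧸ f(A⁺)B) = dim B` -/

section ImageRankAlgebra

variable {k : Type u} {A : Type v} {B : Type w} [Field k] [CommRing A] [Bialgebra k A] [CommRing B] [HopfAlgebra k B]

section Lift

variable (I : Ideal A) [(I.restrictScalars k).IsCoideal] (f : A →ₐc[k] B) (hI : ∀ a : A, a ∈ I → (f : A →ₐ[k] B) a = 0)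

/-- For a coideal `I` killed by the bialgebra map `f`, the induced algebra map `f̄ : A ⧸ I → B` RESPECTS THE COUNITS (`ε_B ∘ f̄ = ε_{A⧸I}`: both are
`ε_A` after the surjection `A ↠ A ⧸ I`). [cite: Milne2017, Ch. 3 §b Prop. 3.9] -/
theorem counitAlgHom_comp_liftₐ :
    (Bialgebra.counitAlgHom k B).comp (Ideal.Quotient.liftₐ I (f : A →ₐ[k] B) hI) = Bialgebra.counitAlgHom k (A ⧸ I) := by
  refine Ideal.Quotient.algHom_ext (R₁ := k) ?_
  rw [AlgHom.comp_assoc, Ideal.Quotient.liftₐ_comp, BialgHom.counitAlgHom_comp]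
  exact AlgHom.ext fun _ => rfl

/-- For a coideal `I` killed by the bialgebra map `f`, the induced algebra map `f̄ : A ⧸ I → B` RESPECTS THE COMULTIPLICATIONS
(`(f̄ ⊗ f̄) ∘ Δ_{A⧸I} = Δ_B ∘ f̄`: after the surjection `A ↠ A ⧸ I` both are `(f ⊗ f) ∘ Δ_A = Δ_B ∘ f`). [cite: Milne2017, Ch. 3 §b Prop. 3.9] -/
theorem map_liftₐ_comp_comulAlgHom :
    (Algebra.TensorProduct.map (Ideal.Quotient.liftₐ I (f : A →ₐ[k] B) hI) (Ideal.Quotient.liftₐ I (f : A →ₐ[k] B) hI)).comp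
        (Bialgebra.comulAlgHom k (A ⧸ I)) =
      (Bialgebra.comulAlgHom k B).comp (Ideal.Quotient.liftₐ I (f : A →ₐ[k] B) hI) := by
  refine Ideal.Quotient.algHom_ext (R₁ := k) ?_
  have hmk : (Bialgebra.comulAlgHom k (A ⧸ I)).comp (Ideal.Quotient.mkₐ k I) =
      (Algebra.TensorProduct.map (Ideal.Quotient.mkₐ k I) (Ideal.Quotient.mkₐ k I)).comp (Bialgebra.comulAlgHom k A) :=
    AlgHom.ext fun _ => rfl
  rw [AlgHom.comp_assoc, AlgHom.comp_assoc, Ideal.Quotient.liftₐ_comp, ← BialgHom.map_comp_comulAlgHom f, hmk, ← AlgHom.comp_assoc,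
    ← Algebra.TensorProduct.map_comp, Ideal.Quotient.liftₐ_comp]

/-- `f̄((A ⧸ I)⁺) B = f(A⁺) B`: the ideal of `B` generated by the image of the augmentation ideal is the same for `f` and for its factorisation `f̄`
through `A ⧸ I` (the augmentation ideal of `A ⧸ I` is the image of that of `A`). [cite: Milne2017, Ch. 3 §b Prop. 3.9] [cite: Waterhouse1979, §2.1 p. 14] -/
theorem map_ker_counit_liftₐ_eq :
    (RingHom.ker (Bialgebra.counitAlgHom k (A ⧸ I))).map (Ideal.Quotient.liftₐ I (f : A →ₐ[k] B) hI) =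
      (RingHom.ker (Bialgebra.counitAlgHom k A)).map (f : A →ₐ[k] B) := by
  apply le_antisymm
  · rw [Ideal.map_le_iff_le_comap]
    intro x hx
    obtain ⟨a, rfl⟩ := Ideal.Quotient.mk_surjective x
    rw [Ideal.mem_comap]
    change Ideal.Quotient.lift I ((f : A →ₐ[k] B) : A →+* B) hI (Ideal.Quotient.mk I a) ∈ _
    rw [Ideal.Quotient.lift_mk]
    exact Ideal.mem_map_of_mem _ hx
  · rw [Ideal.map_le_iff_le_comap]
    intro a ha
    rw [Ideal.mem_comap]
    have hfa : (f : A →ₐ[k] B) a = Ideal.Quotient.liftₐ I (f : A →ₐ[k] B) hI (Ideal.Quotient.mk I a) := rfl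
    rw [hfa]
    exact Ideal.mem_map_of_mem _ (show Ideal.Quotient.mk I a ∈ RingHom.ker (Bialgebra.counitAlgHom k (A ⧸ I)) from ha)

end Lift

variable [FiniteDimensional k B]

/-- **IMAGE RANK (Hopf-algebra form).**  For a bialgebra map `f : A → B` of a commutative `k`-bialgebra into a finite-dimensional commutative Hopf
algebra, `dim_k (A ⧸ ker f) · dim_k (B ⧸ f(A⁺) B) = dim_k B`: `ker f` is a coideal (★ Milne 3.11 `Tannakian.isCoideal_ker_bialgHom`), the induced
`f̄ : A ⧸ ker f ↪ B` is an INJECTIVE bialgebra map (its image is the image Hopf subalgebra, Milne 3.9), `B` is free over it (★ Nichols–Zoeller ∕ Waterhouse 14.1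
`FreeOverSubbialgebra.finrank_mul_finrank_of_injective`) and `f̄((A ⧸ ker f)⁺) B = f(A⁺) B`.
[cite: Milne2017, Ch. 3 §b Prop. 3.9, Prop. 3.11] [cite: Waterhouse1979, §14.1 Theorem] [cite: Montgomery1993Hopf, Theorem 3.1.5 (p. 30), Corollary 3.2.1] -/
theorem finrank_quotient_ker_mul_finrank_quotient_map_ker_counit (f : A →ₐc[k] B) :
    Module.finrank k (A ⧸ RingHom.ker (f : A →ₐ[k] B)) *
        Module.finrank k (B ⧸ (RingHom.ker (Bialgebra.counitAlgHom k A)).map (f : A →ₐ[k] B)) =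
      Module.finrank k B := by
  haveI := Tannakian.isCoideal_ker_bialgHom f
  have hI : ∀ a : A, a ∈ RingHom.ker (f : A →ₐ[k] B) → (f : A →ₐ[k] B) a = 0 := fun _ ha => ha
  let fbar : (A ⧸ RingHom.ker (f : A →ₐ[k] B)) →ₐc[k] B :=
    BialgHom.ofAlgHom (Ideal.Quotient.liftₐ _ (f : A →ₐ[k] B) hI) (counitAlgHom_comp_liftₐ _ f hI)
      (map_liftₐ_comp_comulAlgHom _ f hI)
  have hinj : Function.Injective fbar := by
    change Function.Injective (Ideal.Quotient.lift (RingHom.ker (f : A →ₐ[k] B)) ((f : A →ₐ[k] B) : A →+* B) hI)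
    exact RingHom.lift_injective_of_ker_le_ideal _ hI fun _ hx => hx
  have h := FreeOverSubbialgebra.finrank_mul_finrank_of_injective fbar hinj
  have hmap : (RingHom.ker (Bialgebra.counitAlgHom k (A ⧸ RingHom.ker (f : A →ₐ[k] B)))).map fbar =
      (RingHom.ker (Bialgebra.counitAlgHom k A)).map (f : A →ₐ[k] B) :=
    map_ker_counit_liftₐ_eq _ f hI
  rw [hmap] at h
  exact h

/-- Lagrange for images: `dim_k (A ⧸ ker f) ∣ dim_k B` (the image Hopf subalgebra `A ⧸ ker f ↪ B`). [cite: Milne2017, Ch. 3 §b Prop. 3.9]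
[cite: Montgomery1993Hopf, Corollary 3.2.1 (p. 30)] -/
theorem finrank_quotient_ker_dvd (f : A →ₐc[k] B) : Module.finrank k (A ⧸ RingHom.ker (f : A →ₐ[k] B)) ∣ Module.finrank k B :=
  Dvd.intro _ (finrank_quotient_ker_mul_finrank_quotient_map_ker_counit f)

end ImageRankAlgebra

/-! ## §3 Schemes: the rank of the image of a homomorphism of finite group schemes over a field -/

section ImageRankScheme

variable {k : Type u} [Field k] {G₁ G₂ : SchemeOver k} [GrpObj G₁] [GrpObj G₂] [IsAffine G₁.left] [IsAffine G₂.left] (φ : G₁ ⟶ G₂)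
  [IsMonHom φ]

/-- **The image ideal `ker Γ(φ) ⊆ Γ(G₂)` of a homomorphism `φ : G₁ → G₂` of affine group schemes over a field is a Hopf ideal** — the scheme-theoretic
image `V(ker Γ(φ))` is a closed subgroup scheme of `G₂` (★ Milne 3.11 `Tannakian.isHopfIdeal_ker_bialgHom` at the bialgebra map ★ `Alg.comapBialgHom φ`).
[cite: Milne2017, Ch. 3 §b Prop. 3.11, Prop. 3.15] -/
theorem isHopfIdeal_ker_comap : (RingHom.ker (Alg.comap φ)).IsHopfIdeal k :=
  Tannakian.isHopfIdeal_ker_bialgHom (Alg.comapBialgHom φ)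

omit [GrpObj G₁] [GrpObj G₂] [IsAffine G₁.left] [IsAffine G₂.left] [IsMonHom φ] in
/-- `ker Γ(φ)` in the two spellings of the tree: `RingHom.ker (Alg.comap φ) = RingHom.ker φ.left.appTop.hom` (★ `Alg.comap_apply`, `rfl`).
[cite: Milne2017, Ch. 3 §b Prop. 3.15] -/
theorem ker_comap_eq_ker_appTop : RingHom.ker (Alg.comap φ) = (RingHom.ker φ.left.appTop.hom : Ideal (Alg G₂)) := rfl

variable [Module.Finite k (Alg G₁)]

/-- **IMAGE RANK, ideal currency: `dim_k (Γ(G₂) ⧸ ker Γ(φ)) · dim_k (Γ(G₁) ⧸ J(φ)) = dim_k Γ(G₁)`** for a homomorphism `φ : G₁ → G₂` of affine group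
schemes over a field with `Γ(G₁)` finite, `J(φ) = (ker ε₂).map Γ(φ)` the ideal of `Ker φ` (★ `ker_appTop_kerι_eq`): the order of `G₁` is the order of its
image times the order of its kernel. [cite: Milne2017, Ch. 11 §b Prop. 11.10; Ch. 3 §b Prop. 3.9] [cite: Waterhouse1979, §14.1 Theorem; §2.1 p. 14] -/
theorem finrank_quotient_ker_comap_mul_finrank_quotient_map_ker_counit :
    Module.finrank k (Alg G₂ ⧸ RingHom.ker (Alg.comap φ)) *
        Module.finrank k (Alg G₁ ⧸ (RingHom.ker (Bialgebra.counitAlgHom k (Alg G₂))).map (Alg.comap φ)) =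
      Module.finrank k (Alg G₁) :=
  finrank_quotient_ker_mul_finrank_quotient_map_ker_counit (Alg.comapBialgHom φ)

/-- **IMAGE RANK, kernel currency: `dim_k (Γ(G₂) ⧸ ker Γ(φ)) · dim_k Γ(Ker φ) = dim_k Γ(G₁)`** (★ `finrank_alg_ker_eq`: `Γ(Ker φ) ≅ Γ(G₁) ⧸ J(φ)`).
[cite: Milne2017, Ch. 11 §b Prop. 11.10] [cite: Waterhouse1979, §14.1 Theorem; §2.1 p. 14] -/
theorem finrank_quotient_ker_comap_mul_finrank_alg_ker :
    Module.finrank k (Alg G₂ ⧸ RingHom.ker (Alg.comap φ)) * Module.finrank k (Alg (ker φ)) = Module.finrank k (Alg G₁) := by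
  rw [finrank_alg_ker_eq φ]
  exact finrank_quotient_ker_comap_mul_finrank_quotient_map_ker_counit φ

/-- Lagrange for images of group-scheme homomorphisms: `dim_k (Γ(G₂) ⧸ ker Γ(φ)) ∣ dim_k Γ(G₁)`. [cite: Milne2017, Ch. 11 §b Prop. 11.10]
[cite: Montgomery1993Hopf, Corollary 3.2.1 (p. 30)] -/
theorem finrank_quotient_ker_comap_dvd : Module.finrank k (Alg G₂ ⧸ RingHom.ker (Alg.comap φ)) ∣ Module.finrank k (Alg G₁) :=
  Dvd.intro _ (finrank_quotient_ker_comap_mul_finrank_quotient_map_ker_counit φ)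

omit [Module.Finite k (Alg G₁)] in
/-- `J(φ) = φ^*(Γ(G₂)⁺)·Γ(G₁)` lies in the augmentation ideal of `Γ(G₁)` (`ε₁ ∘ Γ(φ) = ε₂`, ★ `counitAlgHom_comp_comap`), so it is a proper ideal.
[cite: Waterhouse1979, §2.1 p. 14] -/
theorem map_ker_counit_comap_ne_top :
    (RingHom.ker (Bialgebra.counitAlgHom k (Alg G₂))).map (Alg.comap φ) ≠ ⊤ := by
  have hle : (RingHom.ker (Bialgebra.counitAlgHom k (Alg G₂))).map (Alg.comap φ) ≤ RingHom.ker (Bialgebra.counitAlgHom k (Alg G₁)) := by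
    rw [Ideal.map_le_iff_le_comap]
    intro a ha
    rw [Ideal.mem_comap, RingHom.mem_ker, ← AlgHom.comp_apply, counitAlgHom_comp_comap]
    exact ha
  intro htop
  rw [htop, top_le_iff] at hle
  exact RingHom.ker_ne_top (Bialgebra.counitAlgHom k (Alg G₁)) hle

/-- `Γ(G₁) ⧸ J(φ)` has POSITIVE dimension (it is `Γ(Ker φ)`, a nonzero finite `k`-algebra). [cite: Waterhouse1979, §2.1 p. 14] -/
theorem finrank_quotient_map_ker_counit_comap_pos :
    0 < Module.finrank k (Alg G₁ ⧸ (RingHom.ker (Bialgebra.counitAlgHom k (Alg G₂))).map (Alg.comap φ)) := by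
  haveI : Nontrivial (Alg G₁ ⧸ (RingHom.ker (Bialgebra.counitAlgHom k (Alg G₂))).map (Alg.comap φ)) :=
    Ideal.Quotient.nontrivial_iff.mpr (map_ker_counit_comap_ne_top φ)
  haveI : Module.Finite k (Alg G₁ ⧸ (RingHom.ker (Bialgebra.counitAlgHom k (Alg G₂))).map (Alg.comap φ)) :=
    Module.Finite.of_surjective (Ideal.Quotient.mkₐ k _).toLinearMap Ideal.Quotient.mk_surjective
  exact Module.finrank_pos

/-- **The corank of the image ideal as a quotient: `dim_k (Γ(G₂) ⧸ ker Γ(φ)) = dim_k Γ(G₁) ⁄ dim_k (Γ(G₁) ⧸ J(φ))`.** [cite: Milne2017, Ch. 11 §b Prop. 11.10] -/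
theorem finrank_quotient_ker_comap_eq_div :
    Module.finrank k (Alg G₂ ⧸ RingHom.ker (Alg.comap φ)) =
      Module.finrank k (Alg G₁) / Module.finrank k (Alg G₁ ⧸ (RingHom.ker (Bialgebra.counitAlgHom k (Alg G₂))).map (Alg.comap φ)) := by
  rw [← finrank_quotient_ker_comap_mul_finrank_quotient_map_ker_counit φ,
    Nat.mul_div_cancel _ (finrank_quotient_map_ker_counit_comap_pos φ)]

/-- **The corank of the image ideal in numbers**: if `dim_k Γ(G₁) = n · m` and the kernel has order `dim_k (Γ(G₁) ⧸ J(φ)) = m`, then the image has order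
`dim_k (Γ(G₂) ⧸ ker Γ(φ)) = n` (e.g. `q² = q · q` on the `𝔭`-torsion block of an abelian surface-type layer). [cite: Milne2017, Ch. 11 §b Prop. 11.10] -/
theorem finrank_quotient_ker_comap_eq_of_finrank_eq {n m : ℕ} (hG₁ : Module.finrank k (Alg G₁) = n * m)
    (hJ : Module.finrank k (Alg G₁ ⧸ (RingHom.ker (Bialgebra.counitAlgHom k (Alg G₂))).map (Alg.comap φ)) = m) :
    Module.finrank k (Alg G₂ ⧸ RingHom.ker (Alg.comap φ)) = n := by
  have hm : 0 < m := hJ ▸ finrank_quotient_map_ker_counit_comap_pos φ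
  have h := finrank_quotient_ker_comap_mul_finrank_quotient_map_ker_counit φ
  rw [hJ, hG₁] at h
  exact Nat.eq_of_mul_eq_mul_right hm h

end ImageRankScheme

/-! ## §4 HEAD: an ideal below the image ideal with the image corank IS the image ideal -/

section Recognition

variable {k : Type u} [Field k] {G₁ G₂ : SchemeOver k} [GrpObj G₁] [GrpObj G₂] [IsAffine G₁.left] [IsAffine G₂.left] (φ : G₁ ⟶ G₂)
  [IsMonHom φ] [Module.Finite k (Alg G₁)] [Module.Finite k (Alg G₂)]

/-- **HEAD — IMAGE IDEAL RECOGNISED BY RANK.**  For a homomorphism `φ : G₁ → G₂` of finite group schemes over a field, an ideal `I ⊆ Γ(G₂)` with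
`I ≤ ker Γ(φ)` (i.e. `φ` factors through the closed subscheme `V(I)`) and `dim_k (Γ(G₂) ⧸ I) · dim_k (Γ(G₁) ⧸ J(φ)) = dim_k Γ(G₁)` (i.e. `V(I)` has the
order of the image, `= ord G₁ ⁄ ord Ker φ`) IS the image ideal: `I = ker Γ(φ)`. [cite: Milne2017, Ch. 11 §b Prop. 11.10; Ch. 3 §b Prop. 3.15]
[cite: Waterhouse1979, §14.1 Theorem] -/
theorem eq_ker_comap_of_le_of_finrank_quotient_mul_eq {I : Ideal (Alg G₂)} (hI : I ≤ RingHom.ker (Alg.comap φ))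
    (hrk : Module.finrank k (Alg G₂ ⧸ I) *
        Module.finrank k (Alg G₁ ⧸ (RingHom.ker (Bialgebra.counitAlgHom k (Alg G₂))).map (Alg.comap φ)) =
      Module.finrank k (Alg G₁)) :
    I = RingHom.ker (Alg.comap φ) := by
  haveI : FiniteDimensional k (Alg G₂ ⧸ I) :=
    Module.Finite.of_surjective (Ideal.Quotient.mkₐ k I).toLinearMap Ideal.Quotient.mk_surjective
  have heq : Module.finrank k (Alg G₂ ⧸ I) = Module.finrank k (Alg G₂ ⧸ RingHom.ker (Alg.comap φ)) :=
    Nat.eq_of_mul_eq_mul_right (finrank_quotient_map_ker_counit_comap_pos φ)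
      (hrk.trans (finrank_quotient_ker_comap_mul_finrank_quotient_map_ker_counit φ).symm)
  exact ideal_eq_of_le_of_finrank_quotient_eq hI heq

/-- **HEAD in kernel currency**: `I ≤ ker Γ(φ)` and `dim_k (Γ(G₂) ⧸ I) · dim_k Γ(Ker φ) = dim_k Γ(G₁)` give `I = ker Γ(φ)`.
[cite: Milne2017, Ch. 11 §b Prop. 11.10; Ch. 3 §b Prop. 3.15] -/
theorem eq_ker_comap_of_le_of_finrank_quotient_mul_finrank_alg_ker_eq {I : Ideal (Alg G₂)} (hI : I ≤ RingHom.ker (Alg.comap φ))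
    (hrk : Module.finrank k (Alg G₂ ⧸ I) * Module.finrank k (Alg (ker φ)) = Module.finrank k (Alg G₁)) :
    I = RingHom.ker (Alg.comap φ) := by
  rw [finrank_alg_ker_eq φ] at hrk
  exact eq_ker_comap_of_le_of_finrank_quotient_mul_eq φ hI hrk

/-- **HEAD in numbers**: `dim_k Γ(G₁) = n · m`, the kernel has order `dim_k (Γ(G₁) ⧸ J(φ)) = m`, and `I ≤ ker Γ(φ)` has corank `dim_k (Γ(G₂) ⧸ I) = n`
⟹ `I = ker Γ(φ)`.  (The D6 pin: `n = m = q`, `dim Γ(G₀) = q²`.) [cite: Milne2017, Ch. 11 §b Prop. 11.10; Ch. 3 §b Prop. 3.15] -/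
theorem eq_ker_comap_of_le_of_finrank_eq {I : Ideal (Alg G₂)} {n m : ℕ} (hI : I ≤ RingHom.ker (Alg.comap φ))
    (hG₁ : Module.finrank k (Alg G₁) = n * m)
    (hJ : Module.finrank k (Alg G₁ ⧸ (RingHom.ker (Bialgebra.counitAlgHom k (Alg G₂))).map (Alg.comap φ)) = m)
    (hIn : Module.finrank k (Alg G₂ ⧸ I) = n) : I = RingHom.ker (Alg.comap φ) :=
  eq_ker_comap_of_le_of_finrank_quotient_mul_eq φ hI (by rw [hIn, hJ, hG₁])

/-- **HEAD in the `appTop` spelling of the D-line** (`QuotQuot₀Law` reads `RingHom.ker (isogW₀ x̄ H).left.appTop.hom`): `I ≤ ker φ.left.appTop.hom`,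
`dim_k Γ(G₁) = n · m`, `dim_k (Γ(G₁) ⧸ J(φ)) = m`, `dim_k (Γ(G₂) ⧸ I) = n` ⟹ `I = ker φ.left.appTop.hom`. [cite: Milne2017, Ch. 11 §b Prop. 11.10; Ch. 3 §b Prop. 3.15] -/
theorem eq_ker_appTop_of_le_of_finrank_eq {I : Ideal (Alg G₂)} {n m : ℕ} (hI : I ≤ (RingHom.ker φ.left.appTop.hom : Ideal (Alg G₂)))
    (hG₁ : Module.finrank k (Alg G₁) = n * m)
    (hJ : Module.finrank k (Alg G₁ ⧸ (RingHom.ker (Bialgebra.counitAlgHom k (Alg G₂))).map (Alg.comap φ)) = m)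
    (hIn : Module.finrank k (Alg G₂ ⧸ I) = n) : I = (RingHom.ker φ.left.appTop.hom : Ideal (Alg G₂)) :=
  eq_ker_comap_of_le_of_finrank_eq φ hI hG₁ hJ hIn

/-- **HEAD in the `appTop` spelling, kernel currency**: `I ≤ ker φ.left.appTop.hom` and `dim_k (Γ(G₂) ⧸ I) · dim_k Γ(Ker φ) = dim_k Γ(G₁)` ⟹
`I = ker φ.left.appTop.hom`. [cite: Milne2017, Ch. 11 §b Prop. 11.10; Ch. 3 §b Prop. 3.15] -/
theorem eq_ker_appTop_of_le_of_finrank_quotient_mul_finrank_alg_ker_eq {I : Ideal (Alg G₂)}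
    (hI : I ≤ (RingHom.ker φ.left.appTop.hom : Ideal (Alg G₂)))
    (hrk : Module.finrank k (Alg G₂ ⧸ I) * Module.finrank k (Alg (ker φ)) = Module.finrank k (Alg G₁)) :
    I = (RingHom.ker φ.left.appTop.hom : Ideal (Alg G₂)) :=
  eq_ker_comap_of_le_of_finrank_quotient_mul_finrank_alg_ker_eq φ hI hrk

/-- **TWO-IDEAL COROLLARY** («`H′` and the specialised backtracking line coincide»): two ideals below `ker Γ(φ)`, each of the image corank
(`dim_k Γ(G₁) = n · m`, kernel order `m`, both coranks `n`), are EQUAL. [cite: Milne2017, Ch. 11 §b Prop. 11.10; Ch. 3 §b Prop. 3.15] -/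
theorem eq_of_le_ker_comap_of_finrank_eq {I₁ I₂ : Ideal (Alg G₂)} {n m : ℕ} (h₁ : I₁ ≤ RingHom.ker (Alg.comap φ))
    (h₂ : I₂ ≤ RingHom.ker (Alg.comap φ)) (hG₁ : Module.finrank k (Alg G₁) = n * m)
    (hJ : Module.finrank k (Alg G₁ ⧸ (RingHom.ker (Bialgebra.counitAlgHom k (Alg G₂))).map (Alg.comap φ)) = m)
    (hI₁ : Module.finrank k (Alg G₂ ⧸ I₁) = n) (hI₂ : Module.finrank k (Alg G₂ ⧸ I₂) = n) : I₁ = I₂ := by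
  rw [eq_ker_comap_of_le_of_finrank_eq φ h₁ hG₁ hJ hI₁, eq_ker_comap_of_le_of_finrank_eq φ h₂ hG₁ hJ hI₂]

/-- Two-ideal corollary in the `appTop` spelling. [cite: Milne2017, Ch. 11 §b Prop. 11.10; Ch. 3 §b Prop. 3.15] -/
theorem eq_of_le_ker_appTop_of_finrank_eq {I₁ I₂ : Ideal (Alg G₂)} {n m : ℕ}
    (h₁ : I₁ ≤ (RingHom.ker φ.left.appTop.hom : Ideal (Alg G₂))) (h₂ : I₂ ≤ (RingHom.ker φ.left.appTop.hom : Ideal (Alg G₂)))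
    (hG₁ : Module.finrank k (Alg G₁) = n * m)
    (hJ : Module.finrank k (Alg G₁ ⧸ (RingHom.ker (Bialgebra.counitAlgHom k (Alg G₂))).map (Alg.comap φ)) = m)
    (hI₁ : Module.finrank k (Alg G₂ ⧸ I₁) = n) (hI₂ : Module.finrank k (Alg G₂ ⧸ I₂) = n) : I₁ = I₂ :=
  eq_of_le_ker_comap_of_finrank_eq φ h₁ h₂ hG₁ hJ hI₁ hI₂

end Recognition

end AffineGroupScheme

end Literature.AlgebraicGeometry.GroupSchemes
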